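import Literature.Computability.Learning.NWDesignFP
import Literature.Computability.Learning.NaturalLearningPredictor
import Literature.Computability.Complexity.CircuitEval
import HarnessLib

/-!
# `AMP(f) = (f^k)^{GL}` in `FP`: blocks, mask, the GL bit, and evaluation through a circuit

Machine-layer instalment (M2) of the decomposition of the named fact
`Literature.Computability.Learning.cikk_natural_implies_learning` (CIKK 2016, Thm. 5.1). The
amplified function `AMP(f)` of CIKK Thm. 4.3 (`ampFn`, `ampFnFin` of the mathematical layer)
reads its `k·n + k` input bits as `k` blocks of `n` bits (the tuple `x⃗`) followed by `k` mask
bits (`r`), and returns the `𝔽₂` inner product of the mask with `f^k(x⃗)`. As STRING functions: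

* `blockFn ⟨⟨1ⁿ, 1ᶜ⟩, u⟩ = u[c n, c n + n)`, `maskFn ⟨⟨1ⁿ, 1ᵏ⟩, u⟩ = u ⇂ k n` (take/drop
  bricks), with their values on `u = List.ofFn uf` in terms of `ampIdxEquiv`;
* the GL bit itself is `HashBricks.andParityFn ⟨mask, f-bits⟩`; `ampFnFin_eq_andParity` is the
  identity `AMP(f)(uf) = [odd #{c | mask c ∧ f(block c)}]`;
* `fbitsCircFn ⟨d, ⟨⟨1ⁿ, 1ᵏ⟩, u⟩⟩` — the `k` bits `C(block c)` for a circuit description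
  `d = CircEval.desc C` (a concatenation fold of `CircEval.evalFn`), and
  `ampCircFn` — the GL bit computed through the circuit: `ampCircFn_apply_desc`: on
  `⟨desc C, ⟨⟨1ⁿ, 1ᵏ⟩, List.ofFn uf⟩⟩` it returns `[ampFnFin C.eval k uf]`. All in `FP`.

These serve the circuit-size bound for the NW outputs (via `P ⊆ P/poly`) and the learner.

## References

* M. Carmosino, R. Impagliazzo, V. Kabanets, A. Kolokolova, *Learning algorithms from natural
  proofs*, CCC 2016, Thm. 4.3 (steps 1–3: `AMP(f) = (f^k)^{GL}`)
  [CarmosinoImpagliazzoKabanetsKolokolova2016].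
* S. Arora, B. Barak, *Computational Complexity: A Modern Approach*, CUP 2009, §1.3; Thm. 6.18
  (proof: circuit evaluation in polynomial time) [AroraBarak2009].
-/

open Polynomial

namespace Literature.Computability.Learning

open Literature.Computability.Complexity Literature.Computability.Complexity.Brick
  Literature.Computability.Complexity.Plumb Literature.Computability.MetaComplexity
  Literature.Computability.Cryptography _root_.Computability Finset

variable {n k : ℕ}

/-! ### Positions of blocks and mask bits under `ampIdxEquiv` -/

/-- Bit `d` of block `c` sits at position `c·n + d`. [folklore] -/
theorem ampIdxEquiv_inl_val (c : Fin k) (d : Fin n) :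
    ((ampIdxEquiv n k (Sum.inl (c, d)) : Fin (k * n + k)) : ℕ) = c * n + d := by
  simp [ampIdxEquiv, finProdFinEquiv, Fin.castAdd, mul_comm]
  ring

/-- Mask bit `c` sits at position `k·n + c`. [folklore] -/
theorem ampIdxEquiv_inr_val (c : Fin k) :
    ((ampIdxEquiv n k (Sum.inr c) : Fin (k * n + k)) : ℕ) = k * n + c := by
  simp [ampIdxEquiv]

/-! ### Blocks and mask as string functions -/

/-- `blockFn ⟨⟨1ⁿ, 1ᶜ⟩, u⟩ = (u ⇂ c·n) ↾ n`, block `c` of an `AMP` input. [folklore] -/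
noncomputable def blockFn : List Bool → List Bool :=
  takeFn ∘ fanoutFn (fstF ∘ fstF)
    (dropFn ∘ fanoutFn (HashBricks.umulFn ∘ fanoutFn (sndF ∘ fstF) (fstF ∘ fstF)) sndF)

/-- `blockFn ∈ FP`. [folklore] -/
theorem blockFn_mem_FP : blockFn ∈ FP :=
  comp_mem_FP takeFn_mem_FP (fanoutFn_mem_FP (comp_mem_FP fstF_mem_FP fstF_mem_FP)
    (comp_mem_FP dropFn_mem_FP (fanoutFn_mem_FP
      (comp_mem_FP HashBricks.umulFn_mem_FP (fanoutFn_mem_FP (comp_mem_FP sndF_mem_FP fstF_mem_FP)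
        (comp_mem_FP fstF_mem_FP fstF_mem_FP))) sndF_mem_FP)))

/-- Value of `blockFn`. [folklore] -/
@[simp] theorem blockFn_apply (n c : ℕ) (u : List Bool) :
    blockFn (boolPair (boolPair (ones n) (ones c)) u) = (u.drop (c * n)).take n := by
  simp [blockFn, ones]

/-- `maskFn ⟨⟨1ⁿ, 1ᵏ⟩, u⟩ = u ⇂ k·n`, the mask bits of an `AMP` input. [folklore] -/
noncomputable def maskFn : List Bool → List Bool :=
  dropFn ∘ fanoutFn (HashBricks.umulFn ∘ fanoutFn (sndF ∘ fstF) (fstF ∘ fstF)) sndF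

/-- `maskFn ∈ FP`. [folklore] -/
theorem maskFn_mem_FP : maskFn ∈ FP :=
  comp_mem_FP dropFn_mem_FP (fanoutFn_mem_FP
    (comp_mem_FP HashBricks.umulFn_mem_FP (fanoutFn_mem_FP (comp_mem_FP sndF_mem_FP fstF_mem_FP)
      (comp_mem_FP fstF_mem_FP fstF_mem_FP))) sndF_mem_FP)

/-- Value of `maskFn`. [folklore] -/
@[simp] theorem maskFn_apply (n k : ℕ) (u : List Bool) :
    maskFn (boolPair (boolPair (ones n) (ones k)) u) = u.drop (k * n) := by
  simp [maskFn, ones]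

/-- The block of a genuine `AMP` input. [folklore] -/
theorem drop_take_ofFn_eq_block (uf : Fin (k * n + k) → Bool) (c : Fin k) :
    ((List.ofFn uf).drop (c * n)).take n =
      List.ofFn fun d : Fin n => uf (ampIdxEquiv n k (Sum.inl (c, d))) := by
  apply List.ext_getElem
  · simp only [List.length_take, List.length_drop, List.length_ofFn]
    have : n ≤ k * n + k - c * n := by
      have h1 : (c : ℕ) + 1 ≤ k := c.isLt
      have : (c + 1) * n ≤ k * n := Nat.mul_le_mul_right n h1
      rw [add_mul, one_mul] at this
      omega
    omega
  · intro i h1 h2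
    rw [List.length_ofFn] at h2
    simp only [List.getElem_take, List.getElem_drop, List.getElem_ofFn]
    exact congrArg uf (Fin.ext (by rw [ampIdxEquiv_inl_val]))

/-- The mask of a genuine `AMP` input. [folklore] -/
theorem drop_ofFn_eq_mask (uf : Fin (k * n + k) → Bool) :
    (List.ofFn uf).drop (k * n) = List.ofFn fun c : Fin k => uf (ampIdxEquiv n k (Sum.inr c)) := by
  apply List.ext_getElem
  · simp
  · intro i h1 h2
    rw [List.length_ofFn] at h2
    simp only [List.getElem_drop, List.getElem_ofFn]
    exact congrArg uf (Fin.ext (by rw [ampIdxEquiv_inr_val]))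

/-! ### The GL bit as a parity -/

/-- `zipWith` of two `ofFn`s. [folklore] -/
theorem zipWith_ofFn {α β γ : Type*} (g : α → β → γ) {m : ℕ} (a : Fin m → α) (b : Fin m → β) :
    List.zipWith g (List.ofFn a) (List.ofFn b) = List.ofFn fun i => g (a i) (b i) := by
  apply List.ext_getElem
  · simp
  · intro i h1 h2
    simp [List.getElem_zipWith]

/-- Counting `true` in an `ofFn`. [folklore] -/
theorem count_true_ofFn : ∀ {m : ℕ} (b : Fin m → Bool),
    (List.ofFn b).count true = (univ.filter fun i => b i = true).card
  | 0, b => by simp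
  | m + 1, b => by
    rw [List.ofFn_succ, List.count_cons, count_true_ofFn (fun i => b i.succ), Finset.card_filter,
      Finset.card_filter, Fin.sum_univ_succ, add_comm]
    congr 1
    cases b 0 <;> simp

/-- **`AMP(f)` is the parity of the masked `f`-bits**: with the mask `m c = uf(kn + c)` and the
`f`-bits `g c = f(block c)`, `AMP(f)(uf) = [odd #{c | m c ∧ g c}]`, i.e. the value of
`HashBricks.andParityFn ⟨List.ofFn m, List.ofFn g⟩`.
[cite: CarmosinoImpagliazzoKabanetsKolokolova2016, Thm. 4.3 (step 3)] -/
theorem andParityFn_eq_ampFnFin (f : (Fin n → Bool) → Bool) (uf : Fin (k * n + k) → Bool) :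
    HashBricks.andParityFn (boolPair
      (List.ofFn fun c : Fin k => uf (ampIdxEquiv n k (Sum.inr c)))
      (List.ofFn fun c : Fin k => f fun d => uf (ampIdxEquiv n k (Sum.inl (c, d))))) =
      [ampFnFin f k uf] := by
  rw [HashBricks.andParityFn_boolPair, zipWith_ofFn, count_true_ofFn, List.cons.injEq]
  refine ⟨?_, rfl⟩
  -- the GL bit as a sum over `𝔽₂`
  have hamp : ampFnFin f k uf = decide (dpGL f (blocksOf (uf ∘ ampIdxEquiv n k),
      maskOf (uf ∘ ampIdxEquiv n k)) = 1) := rfl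
  have hsum : dpGL f (blocksOf (uf ∘ ampIdxEquiv n k), maskOf (uf ∘ ampIdxEquiv n k)) =
      ∑ c : Fin k, (if (uf (ampIdxEquiv n k (Sum.inr c)) &&
        f fun d => uf (ampIdxEquiv n k (Sum.inl (c, d)))) = true then (1 : ZMod 2) else 0) := by
    simp only [dpGL, dotProduct, dpVec]
    refine Finset.sum_congr rfl fun c _ => ?_
    have hb : blocksOf (uf ∘ ampIdxEquiv n k) c = fun d => uf (ampIdxEquiv n k (Sum.inl (c, d))) :=
      rfl
    have hm : maskOf (uf ∘ ampIdxEquiv n k) c = boolToZMod (uf (ampIdxEquiv n k (Sum.inr c))) := rfl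
    simp only [hb, hm]
    cases uf (ampIdxEquiv n k (Sum.inr c)) <;>
      cases f (fun d => uf (ampIdxEquiv n k (Sum.inl (c, d)))) <;> simp [boolToZMod]
  rw [hamp, hsum, Finset.sum_boole]
  exact decide_eq_decide.2 ZMod.natCast_eq_one_iff_odd.symm

/-! ### Evaluating `f` on the blocks through a circuit description -/

/-- The circuit evaluator on `⟨List.ofFn x, desc C⟩` for a `B₂`-circuit `C` on `Fin n`
(transport of `CircEval.evalFn_boolPair_desc` along `|List.ofFn x| = n`).
[cite: AroraBarak2009, Thm. 6.18 (proof)] -/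
theorem evalFn_boolPair_ofFn_desc (C : Circuit (Fin n)) (hC : C.IsOver B2) (x : Fin n → Bool) :
    CircEval.evalFn (boolPair (List.ofFn x) (CircEval.desc C)) = [C.eval x] := by
  have key : ∀ (m : ℕ) (w : List Bool) (h : w.length = m) (C : Circuit (Fin m)),
      C.IsOver B2 → CircEval.evalFn (boolPair w (CircEval.desc C)) =
        [C.eval fun i => w.get (Fin.cast h.symm i)] := by
    intro m w h
    subst h
    intro C hC
    rw [CircEval.evalFn_boolPair_desc w C (fun g hg => hC g hg)]
    rfl
  rw [key n (List.ofFn x) (List.length_ofFn) C hC]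
  congr 2
  funext i
  simp

/-- The piece of the block-evaluation fold on `⟨⟨d, ⟨⟨1ⁿ, 1ᵏ⟩, u⟩⟩, 1ᶜ⟩`: the bit
`evalFn ⟨block c, d⟩`. [folklore] -/
noncomputable def blockEvalPiece : List Bool → List Bool :=
  CircEval.evalFn ∘ fanoutFn
    (blockFn ∘ fanoutFn (fanoutFn (fstF ∘ fstF ∘ sndF ∘ fstF) sndF) (sndF ∘ sndF ∘ fstF))
    (fstF ∘ fstF)

/-- `blockEvalPiece ∈ FP`. [folklore] -/
theorem blockEvalPiece_mem_FP : blockEvalPiece ∈ FP :=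
  comp_mem_FP CircEval.evalFn_mem_FP (fanoutFn_mem_FP
    (comp_mem_FP blockFn_mem_FP (fanoutFn_mem_FP
      (fanoutFn_mem_FP (comp_mem_FP fstF_mem_FP (comp_mem_FP fstF_mem_FP
        (comp_mem_FP sndF_mem_FP fstF_mem_FP))) sndF_mem_FP)
      (comp_mem_FP sndF_mem_FP (comp_mem_FP sndF_mem_FP fstF_mem_FP))))
    (comp_mem_FP fstF_mem_FP fstF_mem_FP))

/-- Value of `blockEvalPiece`. [folklore] -/
theorem blockEvalPiece_apply (d : List Bool) (n k : ℕ) (u : List Bool) (c : ℕ) :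
    blockEvalPiece (boolPair (boolPair d (boolPair (boolPair (ones n) (ones k)) u)) (ones c)) =
      CircEval.evalFn (boolPair ((u.drop (c * n)).take n) d) := by
  simp [blockEvalPiece]

/-- The pieces are single bits. [folklore] -/
theorem length_blockEvalPiece (w : List Bool) : (blockEvalPiece w).length = 1 := by
  rw [blockEvalPiece, Function.comp_apply]
  rcases CircEval.evalFn_eq_or (fanoutFn
    (blockFn ∘ fanoutFn (fanoutFn (fstF ∘ fstF ∘ sndF ∘ fstF) sndF) (sndF ∘ sndF ∘ fstF))
    (fstF ∘ fstF) w) with h | h <;> rw [h] <;> rfl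

/-- **The `f`-bits through a circuit**: on `Z = ⟨d, ⟨⟨1ⁿ, 1ᵏ⟩, u⟩⟩`, the `k` bits
`evalFn ⟨block c, d⟩`, `c < k`, in order (a concatenation fold).
[cite: AroraBarak2009, Thm. 6.18 (proof)] -/
noncomputable def fbitsCircFn : List Bool → List Bool :=
  sndPow 2 ∘ foldLoop appF (clipF 1 blockEvalPiece) X ∘
    fanoutFn id (fanoutFn (lenBinF ∘ sndF ∘ fstF ∘ sndF) (fun _ => boolPair [] []))

/-- `fbitsCircFn ∈ FP`. [folklore] -/
theorem fbitsCircFn_mem_FP : fbitsCircFn ∈ FP :=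
  comp_mem_FP (sndPow_mem_FP 2) (comp_mem_FP
    (foldLoop_clipF_mem_FP 1 appF_mem_FP length_appF_le blockEvalPiece_mem_FP X)
    (fanoutFn_mem_FP (PolyTimeComputable.id _)
      (fanoutFn_mem_FP (comp_mem_FP lenBinF_mem_FP (comp_mem_FP sndF_mem_FP
        (comp_mem_FP fstF_mem_FP sndF_mem_FP))) (const_mem_FP _))))

/-- Value of `fbitsCircFn`. [folklore] -/
theorem fbitsCircFn_apply (d : List Bool) (n k : ℕ) (u : List Bool) :
    fbitsCircFn (boolPair d (boolPair (boolPair (ones n) (ones k)) u)) =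
      ccat (fun c => CircEval.evalFn (boolPair ((u.drop (c * n)).take n) d)) k := by
  have hk : k ≤ X.eval (boolPair d (boolPair (boolPair (ones n) (ones k)) u)).length := by
    rw [eval_X, length_boolPair, length_boolPair, length_boolPair]
    have : (ones k).length = k := by simp [ones]
    omega
  rw [fbitsCircFn, Function.comp_apply, Function.comp_apply, fanoutFn_apply, fanoutFn_apply, id,
    Function.comp_apply, Function.comp_apply, Function.comp_apply, sndF_boolPair, fstF_boolPair,
    sndF_boolPair, lenBinF_apply, show (ones k).length = k by simp [ones],
    show (boolPair ([] : List Bool) []) = boolPair (ones 0) ([] : List Bool) by rfl,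
    foldLoop_apply _ _ hk,
    foldAcc_clipF (fun j _ _ => by rw [length_blockEvalPiece]; omega), foldAcc_appF]
  simp [sndPow, blockEvalPiece_apply]

/-- **`AMP(f)` through a circuit**: the GL bit `andParityFn ⟨mask, f-bits⟩` with the `f`-bits
computed by the circuit evaluator. [cite: CarmosinoImpagliazzoKabanetsKolokolova2016, Thm. 4.3 (steps 1–3)] -/
noncomputable def ampCircFn : List Bool → List Bool :=
  HashBricks.andParityFn ∘ fanoutFn (maskFn ∘ sndF) fbitsCircFn

/-- `ampCircFn ∈ FP`. [folklore] -/
theorem ampCircFn_mem_FP : ampCircFn ∈ FP :=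
  comp_mem_FP HashBricks.andParityFn_mem_FP
    (fanoutFn_mem_FP (comp_mem_FP maskFn_mem_FP sndF_mem_FP) fbitsCircFn_mem_FP)

/-- **`ampCircFn` computes `AMP(f)` through a `B₂`-circuit for `f`**: on
`⟨desc C, ⟨⟨1ⁿ, 1ᵏ⟩, List.ofFn uf⟩⟩` it returns `[ampFnFin C.eval k uf]`.
[cite: CarmosinoImpagliazzoKabanetsKolokolova2016, Thm. 4.3] -/
theorem ampCircFn_apply_desc (C : Circuit (Fin n)) (hC : C.IsOver B2) (k : ℕ)
    (uf : Fin (k * n + k) → Bool) :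
    ampCircFn (boolPair (CircEval.desc C) (boolPair (boolPair (ones n) (ones k)) (List.ofFn uf))) =
      [ampFnFin (fun x => C.eval x) k uf] := by
  rw [ampCircFn, Function.comp_apply, fanoutFn_apply, Function.comp_apply, sndF_boolPair,
    maskFn_apply, fbitsCircFn_apply, drop_ofFn_eq_mask,
    ccat_congr (g' := fun c => [if h : c < k then
      C.eval (fun d => uf (ampIdxEquiv n k (Sum.inl (⟨c, h⟩, d)))) else false]) (fun c hc => by
      rw [dif_pos hc, drop_take_ofFn_eq_block uf ⟨c, hc⟩, evalFn_boolPair_ofFn_desc C hC]),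
    ccat_singleton_eq_ofFn, ← andParityFn_eq_ampFnFin (fun x => C.eval x) uf]
  congr 2
  refine congrArg List.ofFn (funext fun c => ?_)
  rw [dif_pos c.isLt]

end Literature.Computability.Learning
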